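import Literature.Analysis.FluidPDE.GradientRegularityCriteriaProofs
import HarnessLib

/-!
# Exponent bookkeeping for the pressure-gradient class `∇p ∈ L^s_t L^q_x`, `2/s + 3/q = 3`, `1 < q < 3`

Analysis/FluidPDE proof file (theorems only: no definition, no named fact, no `sorry`).
Search for candidate a priori estimates; no regularity claim. Preparatory lemmas for the assembly
of `Literature.Analysis.FluidPDE.pressureGradientCriterion` in the case `1 < q < 3`
(Lemarié-Rieusset 2016, §11.5 Prop. 11.7; Berselli–Galdi 2002, Thm. 3.3 / Zhou): the Sobolev
exponent `r = 3q/(3-q) ∈ (3/2, ∞)` of the pressure itself (`‖ϖ‖_{L^r} ≲ ‖∇ϖ‖_{L^q}`), the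
identity `s = 1/(1 - 3/(2r)) = 2r/(2r-3)` (the time exponent of the `L⁴` slice inequality
`Literature.Analysis.FluidPDE.lfour_slice_le_of_momentum'` equals the time exponent of the class),
and the finiteness of the Grönwall weight `∫₀ᵀ (M‖∇p(t)‖_{L^q})^s dt` for a member of the class,
twins of `bdv_exponents` / `lintegral_ofReal_rpow_gradient_lt_top`
(`GradientRegularityCriteriaProofs`).

## References

* [LemarieRieusset2016] P. G. Lemarié-Rieusset, *The Navier–Stokes problem in the 21st century*,
  CRC Press 2016 — §11.5, Prop. 11.7 (`σ = 2`: `∇p ∈ L^p_t L^q_x`, `2/p + 3/q = 3`; case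
  `1 < q < 3` via `ϖ ∈ L^r`, `1/r = 1/q - 1/3`), PDF pp. 362–364.
* [BerselliGaldi2002] L. C. Berselli, G. P. Galdi, Proc. AMS 130 (2002) 3585–3595 — Thm. 3.3.
-/

noncomputable section

open MeasureTheory Set Function Filter Topology
open scoped ENNReal NNReal

namespace Literature.Analysis.FluidPDE

/-- **Exponent bookkeeping for the pressure-gradient class.** In `ℝ≥0∞`: if `1 < q < 3` and
`2/s + 3/q = 3` then, with `r = 3q/(3-q)` (the Sobolev exponent of `W^{1,q}(ℝ³) ⊂ L^r`),
`3/2 < r < ∞`, `0 < s < ∞`, `s.toReal = 1/(1 - 3/(2 r.toReal))`, and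
`r.toReal⁻¹ = q.toReal⁻¹ - 3⁻¹`. [cite: LemarieRieusset2016, §11.5 Prop. 11.7 proof (PDF p. 364)] -/
theorem pressureGradient_exponents {s q : ℝ≥0∞} (h1q : 1 < q) (hq3 : q < 3)
    (hsq : 2 / s + 3 / q = 3) :
    3 / 2 < ENNReal.ofReal (3 * q.toReal / (3 - q.toReal)) ∧
      ENNReal.ofReal (3 * q.toReal / (3 - q.toReal)) ≠ ⊤ ∧ s ≠ ⊤ ∧ s ≠ 0 ∧
      s.toReal = 1 / (1 - 3 / (2 * (ENNReal.ofReal (3 * q.toReal / (3 - q.toReal))).toReal)) ∧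
      ((ENNReal.ofReal (3 * q.toReal / (3 - q.toReal))).toReal)⁻¹ = (q.toReal)⁻¹ - 3⁻¹ := by
  have hq0 : q ≠ 0 := (lt_trans zero_lt_one h1q).ne'
  have hqtop : q ≠ ⊤ := (hq3.trans (by simp : (3 : ℝ≥0∞) < ⊤)).ne
  -- the real exponents
  set Q : ℝ := q.toReal with hQ
  have hQ1 : 1 < Q := by
    rw [hQ, ← ENNReal.toReal_one]; exact (ENNReal.toReal_lt_toReal ENNReal.one_ne_top hqtop).2 h1q
  have hQ3 : Q < 3 := by
    have h := (ENNReal.toReal_lt_toReal hqtop (by simp : (3 : ℝ≥0∞) ≠ ⊤)).2 hq3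
    simpa [hQ] using h
  have hQ0 : 0 < Q := by linarith
  have h3Q : 0 < 3 - Q := by linarith
  set R : ℝ := 3 * Q / (3 - Q) with hR
  have hR0 : 0 < R := by positivity
  have hRto : (ENNReal.ofReal R).toReal = R := ENNReal.toReal_ofReal hR0.le
  -- `s ≠ 0`, `s ≠ ⊤`
  have hs0 : s ≠ 0 := by
    rintro rfl
    rw [ENNReal.div_zero (by norm_num : (2 : ℝ≥0∞) ≠ 0), top_add] at hsq
    exact absurd hsq ENNReal.top_ne_ofNat
  have h3q : 3 / q ≠ ⊤ := ENNReal.div_ne_top (by norm_num) hq0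
  have hstop : s ≠ ⊤ := by
    intro hs
    rw [hs, ENNReal.div_top, zero_add] at hsq
    -- `3/q = 3` forces `q = 1`
    have h := congrArg ENNReal.toReal hsq
    rw [ENNReal.toReal_div, ENNReal.toReal_ofNat] at h
    have hq1 : Q = 1 := by
      have h' : (3 : ℝ) / Q = 3 := by simpa [hQ] using h
      field_simp at h'
      linarith
    linarith
  have h2s : 2 / s ≠ ⊤ := ENNReal.div_ne_top (by norm_num) hs0
  -- the real equation `2/S + 3/Q = 3`
  set S : ℝ := s.toReal with hS
  have hSpos : 0 < S := ENNReal.toReal_pos hs0 hstop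
  have hreal : 2 / S + 3 / Q = 3 := by
    have h := congrArg ENNReal.toReal hsq
    rw [ENNReal.toReal_add h2s h3q, ENNReal.toReal_div, ENNReal.toReal_div, ENNReal.toReal_ofNat,
      ENNReal.toReal_ofNat] at h
    simpa [hS, hQ] using h
  refine ⟨?_, ENNReal.ofReal_ne_top, hstop, hs0, ?_, ?_⟩
  · -- `3/2 < r`
    have hR32 : 3 / 2 < R := by
      rw [hR, lt_div_iff₀ h3Q]; linarith
    have h : ((3 / 2 : ℝ≥0∞)).toReal < (ENNReal.ofReal R).toReal := by
      rw [hRto, ENNReal.toReal_div, ENNReal.toReal_ofNat, ENNReal.toReal_ofNat]; exact hR32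
    exact (ENNReal.toReal_lt_toReal (ENNReal.div_ne_top (by norm_num) (by norm_num))
      ENNReal.ofReal_ne_top).1 h
  · -- `S = 1/(1 - 3/(2R))`
    rw [hRto]
    have h1 : 1 - 3 / (2 * R) = 3 * (Q - 1) / (2 * Q) := by
      rw [hR]; field_simp; ring
    have h2 : 2 / S = 3 - 3 / Q := by linarith
    have h3 : S = 2 * Q / (3 * (Q - 1)) := by
      have hQ1' : 0 < Q - 1 := by linarith
      have h2' : 2 / S = 3 * (Q - 1) / Q := by rw [h2]; field_simp
      rw [div_eq_div_iff hSpos.ne' hQ0.ne'] at h2'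
      rw [eq_div_iff (by positivity)]
      linarith
    rw [h1, h3]
    field_simp
  · -- `1/R = 1/Q - 1/3`
    rw [hRto, hR]
    field_simp

/-- **The Grönwall weight of a member of `L^s_t L^q_x` is finite.** For `1 < q < 3`,
`2/s + 3/q = 3`, a field `G ∈ L^s((0,T); L^q)` (`MemLqLp s q G (Ioo 0 T)`) and a constant
`M ≥ 0`, the lower integral `∫₀ᵀ (M ‖G(t)‖_{L^q})^{s'} dt`, `s' = 1/(1 - 3/(2r)) = s.toReal`,
`r = 3q/(3-q)`, is finite, and `G(t) ∈ L^q` for a.e. `t ∈ (0, T)`.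
[cite: LemarieRieusset2016, §11.5 Prop. 11.7 proof, (11.50) (PDF p. 364)] -/
theorem lintegral_ofReal_rpow_pressureGradient_lt_top {X F : Type*} [MeasureSpace X]
    [NormedAddCommGroup F] {s q : ℝ≥0∞} {G : ℝ → X → F} {T : ℝ} (h1q : 1 < q) (hq3 : q < 3)
    (hsq : 2 / s + 3 / q = 3) (hS : MemLqLp s q G (Ioo 0 T)) {M : ℝ} (hM : 0 ≤ M) :
    (∫⁻ t in Ioo 0 T, ENNReal.ofReal
      ((M * (eLpNorm (G t) q volume).toReal) ^
        (1 / (1 - 3 / (2 * (ENNReal.ofReal (3 * q.toReal / (3 - q.toReal))).toReal)))) < ⊤) ∧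
    ∀ᵐ t ∂volume, t ∈ Ioo 0 T → eLpNorm (G t) q volume < ⊤ := by
  obtain ⟨-, -, hstop, hs0, hsθ, -⟩ := pressureGradient_exponents h1q hq3 hsq
  have hSpos : 0 < s.toReal := ENNReal.toReal_pos hs0 hstop
  set N : ℝ → ℝ := fun t => (eLpNorm (G t) q volume).toReal with hN
  have hN0 : ∀ t, 0 ≤ N t := fun t => ENNReal.toReal_nonneg
  refine ⟨?_, ?_⟩
  · have hlt : ∫⁻ t, ‖N t‖ₑ ^ s.toReal ∂(volume.restrict (Ioo 0 T)) < ⊤ :=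
      lintegral_rpow_enorm_lt_top_of_eLpNorm_lt_top hs0 hstop hS.2
    rw [← hsθ]
    have hMs : ENNReal.ofReal (M ^ s.toReal) ≠ ⊤ := ENNReal.ofReal_ne_top
    calc ∫⁻ t in Ioo 0 T, ENNReal.ofReal ((M * N t) ^ s.toReal)
        = ∫⁻ t in Ioo 0 T, ENNReal.ofReal (M ^ s.toReal) * ‖N t‖ₑ ^ s.toReal := by
          refine lintegral_congr fun t => ?_
          rw [Real.mul_rpow hM (hN0 t), ENNReal.ofReal_mul (Real.rpow_nonneg hM _),
            Real.enorm_eq_ofReal (hN0 t), ENNReal.ofReal_rpow_of_nonneg (hN0 t) hSpos.le]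
      _ = ENNReal.ofReal (M ^ s.toReal) * ∫⁻ t in Ioo 0 T, ‖N t‖ₑ ^ s.toReal :=
          lintegral_const_mul' _ _ hMs
      _ < ⊤ := ENNReal.mul_lt_top ENNReal.ofReal_lt_top hlt
  · have h := hS.1
    rw [ae_restrict_iff' measurableSet_Ioo] at h
    filter_upwards [h] with t ht htI
    exact (ht htI).eLpNorm_lt_top

end Literature.Analysis.FluidPDE

end
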